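import Summits.QuantumFields.BalabanUV.Beta.FP.InverseSymbolDeriv
import Summits.QuantumFields.BalabanUV.Beta.FP.SliceLeibnizChain
import Summits.QuantumFields.BalabanUV.Beta.FP.SliceReciprocalChain
import Mathlib.Analysis.Complex.RealDeriv

/-!
# `BalabanUV.Beta.FP.RemainderSymbolChain` — road «FP» for binder row D1, leaf H2-P, row H2-P-B (owner GO l.20595), ABSTRACT ASSEMBLY: the third-order slice
# chain of a REMAINDER SYMBOL `b = −(A₀⁻¹·M₀)_{αβ}·f⁻¹` from the chains of `A₀` (H2-P-INV: `invD1∕2∕3`), of `M₀` and of the scalar `f`, with the graded letters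
# `‖A₀⁻¹‖ ≤ c₀∕r²`, `‖A_j‖ ≤ c_j r^{max(2−j,0)}`, `‖M_j‖ ≤ b·r^{4−j}`, `κr² ≤ |f|`, `|f₁| ≤ e₁r`, `|f₂|,|f₃| ≤ e₂,e₃` ⟹ **`‖b^{(k)}‖ ≤ C_k∕r^k`** (k ≤ 3)

HONEST DEPENDENCY (page 1, mandatory): continuum YM on T⁴ ⇐ BetaPertH ∧ nine spine estimates (0/9 proved); BetaPertH ⇐ (D1) ∧ (D4) ∧ CAP+tail;
G-an2-4 gates asym, D1 and NE2/3/4.  HONEST FRAMING (cell contract, verbatim): «discharging `BetaPertH` makes Bałaban's UV stability UNCONDITIONAL —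
a real constructive-QFT result; it is NOT the continuum limit and NOT the Clay problem.»  THIS MODULE DISCHARGES NOTHING of the wall: [folklore] Leibniz bookkeeping
over `FP/InverseSymbolDeriv` (gan24-leaf-01-g46, p234411), `FP/SliceLeibnizChain` (p234659), `FP/SliceReciprocalChain` (p234721).  Data defs = NAMES of the chain
members (`X0`, `uSl0…3`, `zSl0…3`, `bSl0…bSl3`) and of two explicit constant sums (`aSum`, `cSum`); no `def … : Prop`; nothing cited as a hypothesis; 0 sorry; 0 wall binders; NOT D1, NOT BetaPertH, NOT continuum, NOT Clay.

ABSOLUTE RULE (cell charter, verbatim): «No internally-minted statement may enter as a cited fact. Every hypothesis is either kernel-proved in this package or a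
verbatim quotation of a PUBLISHED theorem with page reference. The manuscript(s) under audit are NOT citable for their own disputed steps — they are the thing
under adjudication; programme-internal (2001/route/tribunal) claims are never citable.»

WHAT (pointwise at one parameter `t`; `A₀ A₁ A₂ A₃ M₀ M₁ M₂ M₃ : ℝ → Matrix ι ι ℂ`, `f f₁ f₂ f₃ : ℝ → ℝ`, an entry `(α, β)`):
* §1 members: `uSl_j` := the `(α,β)` entry of the Leibniz members of `A₀⁻¹·M₀` (`X_j := invD_j` of `InverseSymbolDeriv`, `Y_j := M_j`; `SliceLeibnizChain.mm*`),
  `zSl_j := (rc_j f … : ℂ)` (`SliceReciprocalChain.rc*` coerced), **`bSl0 := −uSl0·zSl0`** (= `−(A₀⁻¹M₀)_{αβ}∕f`), `bSl1∕2∕3 := −ss1∕2∕3(uSl, zSl)`.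
* §2 **`hasDerivAt_bSl0∕1∕2`**: `(bSl_k)′ = bSl_{k+1}` at `t` from the matrix-valued chain `HasDerivAt A_j (A_{j+1} t) t` (+ `IsUnit (A₀ t).det`), the ENTRYWISE chain
  of `M`, and the scalar chain of `f` (`f t ≠ 0`).
* §3 **`norm_bSl0∕1∕2∕3_le`**: with `0 < r ≤ R`, op-norm letters `‖(A₀ t)⁻¹‖ ≤ c₀∕r²`, `‖A₁ t‖ ≤ c₁r`, `‖A₂ t‖ ≤ c₂`, `‖A₃ t‖ ≤ c₃` (the scope of
  `InverseSymbolDeriv`), entry letters `‖M_j t α β‖ ≤ b·r^{4−j}`, scalar letters `κr² ≤ |f t|`, `|f₁ t| ≤ e₁r`, `|f₂ t| ≤ e₂`, `|f₃ t| ≤ e₃`: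
  `‖bSl_k t‖ ≤ 3^k·K·c∕r^k` with `K = n·a·b`, `a := c₀ + c₀²c₁ + (2c₀³c₁² + c₀²c₂) + (6c₀⁴c₁³ + 6c₀³c₁c₂ + c₀²c₃R)` (a common majorant of the four
  `InverseSymbolDeriv` exits) and `c := κ⁻¹ + e₁∕κ² + (2e₁²∕κ³ + e₂∕κ²) + (6e₁³∕κ⁴ + 6e₁e₂∕κ³ + e₃R∕κ²)` — i.e. `∂ᵏb = O(r^{−k})`.
USE (row H2-P-B instance, next file): `A₀ := t ↦ feynMat (Re W_∞(·,·;s(t))) (d1Sym (s(t)))`, `s(t) = i.insertNth t q` (so `(A₀ t)⁻¹ = PinfSym`, `c₀` from H2-P-BND),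
`A_j`, `M_j :=` H2-P-REG's slice derivatives of `feynMat` ∕ `maxwellMat (W − 1)`, `f := DispersionSliceChain.fD q i` (p235073), `r = ‖s(t)‖`, `R = π`;
`bSl0 = B_{αβ}∘s` by `PerfectPropagatorSplit.entry_sub_free_eq`.
Provenance: G-an2-4 swarm leaf prover 05, gen 34 (prover-b2b-balaban-gan24-formalise-leaf-05-g34-0), cross-lane on road FP (row H2-P-B claim l.20249), 2026-08-20.
-/

noncomputable section

namespace Summit.QuantumFields.BalabanUV.Beta.FP.RemainderSymbolChain

open Matrix Filter
open scoped Matrix.Norms.Operator BigOperators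
open Summit.QuantumFields.BalabanUV.Beta.FP.InverseSymbolDeriv (invD1 invD2 invD3 hasDerivAt_inv_apply hasDerivAt_invD1_apply hasDerivAt_invD2_apply
  norm_invD1_entry_le_div_cube norm_invD2_entry_le_div_pow_four norm_invD3_entry_le_div_pow_five)
open Summit.QuantumFields.BalabanUV.Beta.FP.SliceLeibnizChain (mm1 mm2 mm3 hasDerivAt_mm0 hasDerivAt_mm1 hasDerivAt_mm2 ss1 ss2 ss3 hasDerivAt_ss0
  hasDerivAt_ss1 hasDerivAt_ss2 norm_mm0_le_pc norm_mm1_le_pc norm_mm2_le_pc norm_mm3_le_pc norm_ss0_le_pc norm_ss1_le_pc norm_ss2_le_pc norm_ss3_le_pc)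
open Summit.QuantumFields.BalabanUV.Beta.FP.SliceReciprocalChain (rc0 rc1 rc2 rc3 hasDerivAt_rc0 hasDerivAt_rc1 hasDerivAt_rc2 abs_rc0_le_pc abs_rc1_le_pc
  abs_rc2_le_pc abs_rc3_le_pc)
open Summit.QuantumFields.BalabanUV.Beta.GAN24.InverseRate (norm_entry_le)

variable {ι : Type*} [Fintype ι] [DecidableEq ι]

/-! ## §1 The members -/

section Defs

variable (A₀ A₁ A₂ A₃ M₀ M₁ M₂ M₃ : ℝ → Matrix ι ι ℂ) (f f₁ f₂ f₃ : ℝ → ℝ) (α β : ι)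

/-- [our object] `X₀ := A₀⁻¹` as a curve. -/
def X0 (t : ℝ) : Matrix ι ι ℂ := (A₀ t)⁻¹
/-- [our object] `uSl0 := (A₀⁻¹·M₀)_{αβ}`. -/
def uSl0 (t : ℝ) : ℂ := ((A₀ t)⁻¹ * M₀ t) α β
/-- [our object] `uSl1` := the `(α,β)` entry of the first Leibniz member of `A₀⁻¹·M₀`. -/
def uSl1 (t : ℝ) : ℂ := mm1 (X0 A₀) (invD1 A₀ A₁) M₀ M₁ t α β
/-- [our object] `uSl2`. -/
def uSl2 (t : ℝ) : ℂ := mm2 (X0 A₀) (invD1 A₀ A₁) (invD2 A₀ A₁ A₂) M₀ M₁ M₂ t α β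
/-- [our object] `uSl3`. -/
def uSl3 (t : ℝ) : ℂ := mm3 (X0 A₀) (invD1 A₀ A₁) (invD2 A₀ A₁ A₂) (invD3 A₀ A₁ A₂ A₃) M₀ M₁ M₂ M₃ t α β
/-- [our object] `zSl_j := (rc_j f …)` coerced to `ℂ`. -/
def zSl0 (t : ℝ) : ℂ := ((rc0 f t : ℝ) : ℂ)
/-- [our object] `zSl1`. -/
def zSl1 (t : ℝ) : ℂ := ((rc1 f f₁ t : ℝ) : ℂ)
/-- [our object] `zSl2`. -/
def zSl2 (t : ℝ) : ℂ := ((rc2 f f₁ f₂ t : ℝ) : ℂ)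
/-- [our object] `zSl3`. -/
def zSl3 (t : ℝ) : ℂ := ((rc3 f f₁ f₂ f₃ t : ℝ) : ℂ)
/-- [our object] **THE REMAINDER SYMBOL SLICE** `bSl0 := −(A₀⁻¹·M₀)_{αβ} · f⁻¹`. -/
def bSl0 (t : ℝ) : ℂ := -(uSl0 A₀ M₀ α β t * zSl0 f t)
/-- [our object] `bSl1 := −ss1(u, z)`. -/
def bSl1 (t : ℝ) : ℂ := -(ss1 (uSl0 A₀ M₀ α β) (uSl1 A₀ A₁ M₀ M₁ α β) (zSl0 f) (zSl1 f f₁) t)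
/-- [our object] `bSl2 := −ss2(u, z)`. -/
def bSl2 (t : ℝ) : ℂ :=
  -(ss2 (uSl0 A₀ M₀ α β) (uSl1 A₀ A₁ M₀ M₁ α β) (uSl2 A₀ A₁ A₂ M₀ M₁ M₂ α β) (zSl0 f) (zSl1 f f₁) (zSl2 f f₁ f₂) t)
/-- [our object] `bSl3 := −ss3(u, z)`. -/
def bSl3 (t : ℝ) : ℂ :=
  -(ss3 (uSl0 A₀ M₀ α β) (uSl1 A₀ A₁ M₀ M₁ α β) (uSl2 A₀ A₁ A₂ M₀ M₁ M₂ α β) (uSl3 A₀ A₁ A₂ A₃ M₀ M₁ M₂ M₃ α β)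
    (zSl0 f) (zSl1 f f₁) (zSl2 f f₁ f₂) (zSl3 f f₁ f₂ f₃) t)

end Defs

/-! ## §2 The chain `(bSl_k)′ = bSl_{k+1}` -/

section Chain

variable {A₀ A₁ A₂ A₃ M₀ M₁ M₂ M₃ : ℝ → Matrix ι ι ℂ} {f f₁ f₂ f₃ : ℝ → ℝ} {t : ℝ}
  (hA0 : HasDerivAt A₀ (A₁ t) t) (hA1 : HasDerivAt A₁ (A₂ t) t) (hA2 : HasDerivAt A₂ (A₃ t) t) (hdet : IsUnit (A₀ t).det)
  (hM0 : ∀ α β, HasDerivAt (fun s => M₀ s α β) (M₁ t α β) t) (hM1 : ∀ α β, HasDerivAt (fun s => M₁ s α β) (M₂ t α β) t)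
  (hM2 : ∀ α β, HasDerivAt (fun s => M₂ s α β) (M₃ t α β) t)
  (hf0 : HasDerivAt f (f₁ t) t) (hf1 : HasDerivAt f₁ (f₂ t) t) (hf2 : HasDerivAt f₂ (f₃ t) t) (hft : f t ≠ 0)

include hA0 hdet hM0 in
/-- [our object] `(uSl0)′ = uSl1`. -/
theorem hasDerivAt_uSl0 (α β : ι) : HasDerivAt (uSl0 A₀ M₀ α β) (uSl1 A₀ A₁ M₀ M₁ α β t) t := by
  have hX : ∀ α β, HasDerivAt (fun s => X0 A₀ s α β) (invD1 A₀ A₁ t α β) t := fun α β => hasDerivAt_inv_apply hA0 hdet α β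
  have h := hasDerivAt_mm0 (X₀ := X0 A₀) (Y₀ := M₀) hX hM0 α β
  unfold uSl0 uSl1
  exact h

include hA0 hA1 hdet hM0 hM1 in
/-- [our object] `(uSl1)′ = uSl2`. -/
theorem hasDerivAt_uSl1 (α β : ι) : HasDerivAt (uSl1 A₀ A₁ M₀ M₁ α β) (uSl2 A₀ A₁ A₂ M₀ M₁ M₂ α β t) t := by
  have hX : ∀ α β, HasDerivAt (fun s => X0 A₀ s α β) (invD1 A₀ A₁ t α β) t := fun α β => hasDerivAt_inv_apply hA0 hdet α β
  have hX1 : ∀ α β, HasDerivAt (fun s => invD1 A₀ A₁ s α β) (invD2 A₀ A₁ A₂ t α β) t :=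
    fun α β => hasDerivAt_invD1_apply hA0 hA1 hdet α β
  have h := hasDerivAt_mm1 hX hX1 hM0 hM1 α β
  unfold uSl1 uSl2
  exact h

include hA0 hA1 hA2 hdet hM0 hM1 hM2 in
/-- [our object] `(uSl2)′ = uSl3`. -/
theorem hasDerivAt_uSl2 (α β : ι) :
    HasDerivAt (uSl2 A₀ A₁ A₂ M₀ M₁ M₂ α β) (uSl3 A₀ A₁ A₂ A₃ M₀ M₁ M₂ M₃ α β t) t := by
  have hX : ∀ α β, HasDerivAt (fun s => X0 A₀ s α β) (invD1 A₀ A₁ t α β) t := fun α β => hasDerivAt_inv_apply hA0 hdet α β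
  have hX1 : ∀ α β, HasDerivAt (fun s => invD1 A₀ A₁ s α β) (invD2 A₀ A₁ A₂ t α β) t :=
    fun α β => hasDerivAt_invD1_apply hA0 hA1 hdet α β
  have hX2 : ∀ α β, HasDerivAt (fun s => invD2 A₀ A₁ A₂ s α β) (invD3 A₀ A₁ A₂ A₃ t α β) t :=
    fun α β => hasDerivAt_invD2_apply hA0 hA1 hA2 hdet α β
  have h := hasDerivAt_mm2 hX hX1 hX2 hM0 hM1 hM2 α β
  unfold uSl2 uSl3
  exact h

include hf0 hft in
/-- [our object] `(zSl0)′ = zSl1`. -/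
theorem hasDerivAt_zSl0 : HasDerivAt (zSl0 f) (zSl1 f f₁ t) t := by
  unfold zSl0 zSl1; exact (hasDerivAt_rc0 hf0 hft).ofReal_comp

include hf0 hf1 hft in
/-- [our object] `(zSl1)′ = zSl2`. -/
theorem hasDerivAt_zSl1 : HasDerivAt (zSl1 f f₁) (zSl2 f f₁ f₂ t) t := by
  unfold zSl1 zSl2; exact (hasDerivAt_rc1 hf0 hf1 hft).ofReal_comp

include hf0 hf1 hf2 hft in
/-- [our object] `(zSl2)′ = zSl3`. -/
theorem hasDerivAt_zSl2 : HasDerivAt (zSl2 f f₁ f₂) (zSl3 f f₁ f₂ f₃ t) t := by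
  unfold zSl2 zSl3; exact (hasDerivAt_rc2 hf0 hf1 hf2 hft).ofReal_comp

include hA0 hdet hM0 hf0 hft in
/-- [our object] **`(bSl0)′ = bSl1`.** -/
theorem hasDerivAt_bSl0 (α β : ι) : HasDerivAt (bSl0 A₀ M₀ f α β) (bSl1 A₀ A₁ M₀ M₁ f f₁ α β t) t := by
  have h := (hasDerivAt_ss0 (hasDerivAt_uSl0 hA0 hdet hM0 α β) (hasDerivAt_zSl0 hf0 hft)).neg
  unfold bSl0 bSl1
  exact h

include hA0 hA1 hdet hM0 hM1 hf0 hf1 hft in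
/-- [our object] **`(bSl1)′ = bSl2`.** -/
theorem hasDerivAt_bSl1 (α β : ι) : HasDerivAt (bSl1 A₀ A₁ M₀ M₁ f f₁ α β) (bSl2 A₀ A₁ A₂ M₀ M₁ M₂ f f₁ f₂ α β t) t := by
  have h := (hasDerivAt_ss1 (hasDerivAt_uSl0 hA0 hdet hM0 α β) (hasDerivAt_uSl1 hA0 hA1 hdet hM0 hM1 α β)
    (hasDerivAt_zSl0 hf0 hft) (hasDerivAt_zSl1 hf0 hf1 hft)).neg
  unfold bSl1 bSl2
  exact h

include hA0 hA1 hA2 hdet hM0 hM1 hM2 hf0 hf1 hf2 hft in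
/-- [our object] **`(bSl2)′ = bSl3`.** -/
theorem hasDerivAt_bSl2 (α β : ι) :
    HasDerivAt (bSl2 A₀ A₁ A₂ M₀ M₁ M₂ f f₁ f₂ α β) (bSl3 A₀ A₁ A₂ A₃ M₀ M₁ M₂ M₃ f f₁ f₂ f₃ α β t) t := by
  have h := (hasDerivAt_ss2 (hasDerivAt_uSl0 hA0 hdet hM0 α β) (hasDerivAt_uSl1 hA0 hA1 hdet hM0 hM1 α β)
    (hasDerivAt_uSl2 hA0 hA1 hA2 hdet hM0 hM1 hM2 α β)
    (hasDerivAt_zSl0 hf0 hft) (hasDerivAt_zSl1 hf0 hf1 hft) (hasDerivAt_zSl2 hf0 hf1 hf2 hft)).neg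
  unfold bSl2 bSl3
  exact h

end Chain

/-! ## §3 Graded letters ⟹ `‖bSl_k‖ ≤ 3^k·K·c ∕ r^k` -/

/-- [our object] a common majorant of the four `InverseSymbolDeriv` entry exits: `c₀ + c₀²c₁ + (2c₀³c₁² + c₀²c₂) + (6c₀⁴c₁³ + 6c₀³c₁c₂ + c₀²c₃R)`. -/
def aSum (c₀ c₁ c₂ c₃ R : ℝ) : ℝ :=
  c₀ + c₀ ^ 2 * c₁ + (2 * c₀ ^ 3 * c₁ ^ 2 + c₀ ^ 2 * c₂) + (6 * c₀ ^ 4 * c₁ ^ 3 + 6 * c₀ ^ 3 * c₁ * c₂ + c₀ ^ 2 * c₃ * R)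

/-- [our object] a common majorant of the four `SliceReciprocalChain` exits: `κ⁻¹ + e₁∕κ² + (2e₁²∕κ³ + e₂∕κ²) + (6e₁³∕κ⁴ + 6e₁e₂∕κ³ + e₃R∕κ²)`. -/
def cSum (κ e₁ e₂ e₃ R : ℝ) : ℝ :=
  κ⁻¹ + e₁ / κ ^ 2 + (2 * e₁ ^ 2 / κ ^ 3 + e₂ / κ ^ 2) + (6 * e₁ ^ 3 / κ ^ 4 + 6 * (e₁ * e₂) / κ ^ 3 + e₃ * R / κ ^ 2)

section Bounds

variable {A₀ A₁ A₂ A₃ M₀ M₁ M₂ M₃ : ℝ → Matrix ι ι ℂ} {f f₁ f₂ f₃ : ℝ → ℝ} {t : ℝ} {c₀ c₁ c₂ c₃ b κ e₁ e₂ e₃ r R : ℝ}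
  (hr : 0 < r) (hrR : r ≤ R) (hκ : 0 < κ)
  (hp : ‖(A₀ t)⁻¹‖ ≤ c₀ / r ^ 2) (h₁ : ‖A₁ t‖ ≤ c₁ * r) (h₂ : ‖A₂ t‖ ≤ c₂) (h₃ : ‖A₃ t‖ ≤ c₃)
  (bM0 : ∀ α β, ‖M₀ t α β‖ ≤ b * r ^ 4) (bM1 : ∀ α β, ‖M₁ t α β‖ ≤ b * r ^ 3) (bM2 : ∀ α β, ‖M₂ t α β‖ ≤ b * r ^ 2)
  (bM3 : ∀ α β, ‖M₃ t α β‖ ≤ b * r)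
  (pf : κ * r ^ 2 ≤ |f t|) (pf1 : |f₁ t| ≤ e₁ * r) (pf2 : |f₂ t| ≤ e₂) (pf3 : |f₃ t| ≤ e₃)

/-- [folklore] nonnegativity of the letters' constants (from the letters themselves). -/
theorem consts_nonneg (hr : 0 < r) (hrR : r ≤ R) (hp : ‖(A₀ t)⁻¹‖ ≤ c₀ / r ^ 2) (h₁ : ‖A₁ t‖ ≤ c₁ * r) (h₂ : ‖A₂ t‖ ≤ c₂)
    (h₃ : ‖A₃ t‖ ≤ c₃) : 0 ≤ c₀ ∧ 0 ≤ c₁ ∧ 0 ≤ c₂ ∧ 0 ≤ c₃ ∧ 0 ≤ R := by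
  refine ⟨?_, ?_, (norm_nonneg _).trans h₂, (norm_nonneg _).trans h₃, hr.le.trans hrR⟩
  · have := (norm_nonneg _).trans hp
    have hr2 : 0 < r ^ 2 := by positivity
    by_contra hc; push Not at hc
    have : c₀ / r ^ 2 < 0 := div_neg_of_neg_of_pos hc hr2
    linarith
  · have := (norm_nonneg _).trans h₁
    by_contra hc; push Not at hc
    have : c₁ * r < 0 := mul_neg_of_neg_of_pos hc hr
    linarith

include hr hrR hp h₁ h₂ h₃ in
/-- [our object] THE `X`-LETTERS: `‖invD_j t α β‖ ≤ aSum∕r^{2+j}` (`j = 0,…,3`; `InverseSymbolDeriv` §4 exits + `norm_entry_le`, each majorised by `aSum`). -/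
theorem xLetters (α β : ι) :
    ‖X0 A₀ t α β‖ ≤ aSum c₀ c₁ c₂ c₃ R / r ^ 2 ∧ ‖invD1 A₀ A₁ t α β‖ ≤ aSum c₀ c₁ c₂ c₃ R / r ^ 3 ∧
      ‖invD2 A₀ A₁ A₂ t α β‖ ≤ aSum c₀ c₁ c₂ c₃ R / r ^ 4 ∧ ‖invD3 A₀ A₁ A₂ A₃ t α β‖ ≤ aSum c₀ c₁ c₂ c₃ R / r ^ 5 := by
  obtain ⟨hc0, hc1, hc2, hc3, hR⟩ := consts_nonneg hr hrR hp h₁ h₂ h₃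
  have hK1 : 0 ≤ c₀ ^ 2 * c₁ := by positivity
  have hK2 : 0 ≤ 2 * c₀ ^ 3 * c₁ ^ 2 + c₀ ^ 2 * c₂ := by positivity
  have hK3 : 0 ≤ 6 * c₀ ^ 4 * c₁ ^ 3 + 6 * c₀ ^ 3 * c₁ * c₂ + c₀ ^ 2 * c₃ * R := by positivity
  have ha0 : c₀ ≤ aSum c₀ c₁ c₂ c₃ R := by unfold aSum; linarith
  have ha1 : c₀ ^ 2 * c₁ ≤ aSum c₀ c₁ c₂ c₃ R := by unfold aSum; linarith
  have ha2 : 2 * c₀ ^ 3 * c₁ ^ 2 + c₀ ^ 2 * c₂ ≤ aSum c₀ c₁ c₂ c₃ R := by unfold aSum; linarith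
  have ha3 : 6 * c₀ ^ 4 * c₁ ^ 3 + 6 * c₀ ^ 3 * c₁ * c₂ + c₀ ^ 2 * c₃ * R ≤ aSum c₀ c₁ c₂ c₃ R := by unfold aSum; linarith
  refine ⟨?_, ?_, ?_, ?_⟩
  · unfold X0
    exact ((norm_entry_le _ α β).trans hp).trans (div_le_div_of_nonneg_right ha0 (by positivity))
  · exact (norm_invD1_entry_le_div_cube hr hp h₁ α β).trans (div_le_div_of_nonneg_right ha1 (by positivity))
  · exact (norm_invD2_entry_le_div_pow_four hr hp h₁ h₂ α β).trans (div_le_div_of_nonneg_right ha2 (by positivity))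
  · exact (norm_invD3_entry_le_div_pow_five hr hrR hp h₁ h₂ h₃ α β).trans (div_le_div_of_nonneg_right ha3 (by positivity))

include hr hrR hp h₁ h₂ h₃ bM0 bM1 bM2 bM3 in
/-- [our object] THE `u`-LETTERS: `‖uSl_j t‖ ≤ 2^j·K·r^{2−j}`, `K = n·aSum·b` (`SliceLeibnizChain.norm_mm*_le_pc`). -/
theorem uLetters (α β : ι) :
    ‖uSl0 A₀ M₀ α β t‖ ≤ (Fintype.card ι * (aSum c₀ c₁ c₂ c₃ R * b)) * r ^ 2 ∧
      ‖uSl1 A₀ A₁ M₀ M₁ α β t‖ ≤ 2 * (Fintype.card ι * (aSum c₀ c₁ c₂ c₃ R * b)) * r ∧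
      ‖uSl2 A₀ A₁ A₂ M₀ M₁ M₂ α β t‖ ≤ 4 * (Fintype.card ι * (aSum c₀ c₁ c₂ c₃ R * b)) ∧
      ‖uSl3 A₀ A₁ A₂ A₃ M₀ M₁ M₂ M₃ α β t‖ ≤ 8 * (Fintype.card ι * (aSum c₀ c₁ c₂ c₃ R * b)) / r := by
  have hX := fun α β => xLetters hr hrR hp h₁ h₂ h₃ α β
  have pX0 : ∀ α β, ‖X0 A₀ t α β‖ ≤ aSum c₀ c₁ c₂ c₃ R / r ^ 2 := fun α β => (hX α β).1
  have pX1 : ∀ α β, ‖invD1 A₀ A₁ t α β‖ ≤ aSum c₀ c₁ c₂ c₃ R / r ^ 3 := fun α β => (hX α β).2.1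
  have pX2 : ∀ α β, ‖invD2 A₀ A₁ A₂ t α β‖ ≤ aSum c₀ c₁ c₂ c₃ R / r ^ 4 := fun α β => (hX α β).2.2.1
  have pX3 : ∀ α β, ‖invD3 A₀ A₁ A₂ A₃ t α β‖ ≤ aSum c₀ c₁ c₂ c₃ R / r ^ 5 := fun α β => (hX α β).2.2.2
  refine ⟨?_, ?_, ?_, ?_⟩
  · unfold uSl0
    have := norm_mm0_le_pc (X₀ := X0 A₀) (Y₀ := M₀) hr pX0 bM0 α β
    unfold X0 at this; exact this
  · unfold uSl1; exact norm_mm1_le_pc hr pX0 pX1 bM0 bM1 α β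
  · unfold uSl2; exact norm_mm2_le_pc hr pX0 pX1 pX2 bM0 bM1 bM2 α β
  · unfold uSl3; exact norm_mm3_le_pc hr pX0 pX1 pX2 pX3 bM0 bM1 bM2 bM3 α β

include hr hrR hκ pf pf1 pf2 pf3 in
/-- [our object] THE `z`-LETTERS: `‖zSl_j t‖ ≤ cSum∕r^{2+j}` (`SliceReciprocalChain.abs_rc*_le_pc`, each majorised by `cSum`). -/
theorem zLetters :
    ‖zSl0 f t‖ ≤ cSum κ e₁ e₂ e₃ R / r ^ 2 ∧ ‖zSl1 f f₁ t‖ ≤ cSum κ e₁ e₂ e₃ R / r ^ 3 ∧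
      ‖zSl2 f f₁ f₂ t‖ ≤ cSum κ e₁ e₂ e₃ R / r ^ 4 ∧ ‖zSl3 f f₁ f₂ f₃ t‖ ≤ cSum κ e₁ e₂ e₃ R / r ^ 5 := by
  have he1 : 0 ≤ e₁ := by
    have := (abs_nonneg _).trans pf1
    by_contra hc; push Not at hc
    have : e₁ * r < 0 := mul_neg_of_neg_of_pos hc hr
    linarith
  have he2 : 0 ≤ e₂ := (abs_nonneg _).trans pf2
  have he3 : 0 ≤ e₃ := (abs_nonneg _).trans pf3
  have hR : 0 ≤ R := hr.le.trans hrR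
  have t0 : 0 ≤ κ⁻¹ := by positivity
  have t1 : 0 ≤ e₁ / κ ^ 2 := by positivity
  have t2 : 0 ≤ 2 * e₁ ^ 2 / κ ^ 3 + e₂ / κ ^ 2 := by positivity
  have t3 : 0 ≤ 6 * e₁ ^ 3 / κ ^ 4 + 6 * (e₁ * e₂) / κ ^ 3 + e₃ * R / κ ^ 2 := by positivity
  have c0 : κ⁻¹ ≤ cSum κ e₁ e₂ e₃ R := by unfold cSum; linarith
  have c1 : e₁ / κ ^ 2 ≤ cSum κ e₁ e₂ e₃ R := by unfold cSum; linarith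
  have c2 : 2 * e₁ ^ 2 / κ ^ 3 + e₂ / κ ^ 2 ≤ cSum κ e₁ e₂ e₃ R := by unfold cSum; linarith
  have c3 : 6 * e₁ ^ 3 / κ ^ 4 + 6 * (e₁ * e₂) / κ ^ 3 + e₃ * R / κ ^ 2 ≤ cSum κ e₁ e₂ e₃ R := by unfold cSum; linarith
  unfold zSl0 zSl1 zSl2 zSl3
  simp only [Complex.norm_real, Real.norm_eq_abs]
  refine ⟨?_, ?_, ?_, ?_⟩
  · exact (abs_rc0_le_pc hr hκ pf).trans (div_le_div_of_nonneg_right c0 (by positivity))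
  · exact (abs_rc1_le_pc hr hκ pf pf1).trans (div_le_div_of_nonneg_right c1 (by positivity))
  · exact (abs_rc2_le_pc hr hκ pf pf1 pf2).trans (div_le_div_of_nonneg_right c2 (by positivity))
  · exact (abs_rc3_le_pc hr hκ hrR pf pf1 pf2 pf3).trans (div_le_div_of_nonneg_right c3 (by positivity))

include hr hrR hκ hp h₁ h₂ h₃ bM0 bM1 bM2 bM3 pf pf1 pf2 pf3 in
/-- [our object] **THE GRADED REMAINDER CHAIN**: with `K := n·aSum·b`, `c := cSum`:
`‖bSl0 t‖ ≤ K·c`, `‖bSl1 t‖ ≤ 3Kc∕r`, `‖bSl2 t‖ ≤ 9Kc∕r²`, `‖bSl3 t‖ ≤ 27Kc∕r³` — `∂ᵏb = O(r^{−k})`, `k ≤ 3`. -/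
theorem norm_bSl_le (α β : ι) :
    ‖bSl0 A₀ M₀ f α β t‖ ≤ (Fintype.card ι * (aSum c₀ c₁ c₂ c₃ R * b)) * cSum κ e₁ e₂ e₃ R ∧
      ‖bSl1 A₀ A₁ M₀ M₁ f f₁ α β t‖ ≤ 3 * ((Fintype.card ι * (aSum c₀ c₁ c₂ c₃ R * b)) * cSum κ e₁ e₂ e₃ R) / r ∧
      ‖bSl2 A₀ A₁ A₂ M₀ M₁ M₂ f f₁ f₂ α β t‖ ≤ 9 * ((Fintype.card ι * (aSum c₀ c₁ c₂ c₃ R * b)) * cSum κ e₁ e₂ e₃ R) / r ^ 2 ∧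
      ‖bSl3 A₀ A₁ A₂ A₃ M₀ M₁ M₂ M₃ f f₁ f₂ f₃ α β t‖
        ≤ 27 * ((Fintype.card ι * (aSum c₀ c₁ c₂ c₃ R * b)) * cSum κ e₁ e₂ e₃ R) / r ^ 3 := by
  obtain ⟨pu0, pu1, pu2, pu3⟩ := uLetters hr hrR hp h₁ h₂ h₃ bM0 bM1 bM2 bM3 α β
  obtain ⟨pz0, pz1, pz2, pz3⟩ := zLetters hr hrR hκ pf pf1 pf2 pf3 (f := f) (f₁ := f₁) (f₂ := f₂) (f₃ := f₃)
  unfold bSl0 bSl1 bSl2 bSl3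
  simp only [norm_neg]
  exact ⟨norm_ss0_le_pc hr pu0 pz0, norm_ss1_le_pc hr pu0 pu1 pz0 pz1, norm_ss2_le_pc hr pu0 pu1 pu2 pz0 pz1 pz2,
    norm_ss3_le_pc hr pu0 pu1 pu2 pu3 pz0 pz1 pz2 pz3⟩

end Bounds

end Summit.QuantumFields.BalabanUV.Beta.FP.RemainderSymbolChain

end
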